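import Mathlib
import Summits.Ventures.HodgeRepro2.FormalAdjointEigenvalue
import Summits.Ventures.HodgeRepro2.HeckeFiniteIndex
import Summits.Ventures.HodgeRepro2.MultiplicityOnePeriod

/-!
# HeckeEigenspaceOrthogonal — eigenforms of a self-adjoint Hecke operator with distinct eigenvalues
are Petersson-orthogonal, and their Hodge period pairing vanishes

Blind cell `pub-hodge-repro2`, seat p2 (Tier 5 kernel support).

* `IsFormalAdjointPair.inner_eq_zero_of_eigenvalue_ne` (generic): for a self-adjoint `T`
  (`⟪T x, y⟫ = ⟪x, T y⟫`), eigenvectors with distinct eigenvalues are orthogonal;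
* **`heckeFamilyOf_inner_eq_zero_of_eigenvalue_ne`**: when `T_δ = T_{δ⁻¹}` on the Petersson space,
  `T_δ`-eigenvectors with distinct eigenvalues are orthogonal;
* **`setIntegral_hodgeWedge_eq_zero_of_eigenvalue_ne`**: for weight `3`, the Hodge period pairing
  `∫_D ω_f ∧ conj ω_g` of two such eigenforms vanishes (`= 4 ⟨g, f⟩_Pet`).
-/

namespace Summit.Ventures.HodgeRepro2

namespace JointEigenbasis

section general

variable {𝕜 E : Type*} [RCLike 𝕜] [NormedAddCommGroup E] [InnerProductSpace 𝕜 E]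

/-- **Eigenvectors of a self-adjoint operator with distinct eigenvalues are orthogonal.** -/
theorem IsFormalAdjointPair.inner_eq_zero_of_eigenvalue_ne {T : E →ₗ[𝕜] E}
    (h : IsFormalAdjointPair T T) {v w : E} (hv0 : v ≠ 0) {μ ν : 𝕜} (hv : T v = μ • v)
    (hw : T w = ν • w) (hμν : μ ≠ ν) : inner 𝕜 v w = 0 := by
  -- `μ` is real
  have hreal : μ = (starRingEnd 𝕜) μ := h.eigenvalue_eq_conj hv0 hv hv
  have h1 : inner 𝕜 (T v) w = inner 𝕜 v (T w) := h v w
  rw [hv, hw, inner_smul_left, inner_smul_right, ← hreal] at h1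
  -- `(μ - ν) ⟪v, w⟫ = 0`
  have h2 : (μ - ν) * inner 𝕜 v w = 0 := by rw [sub_mul, h1, sub_self]
  rcases mul_eq_zero.mp h2 with h3 | h3
  · exact absurd (sub_eq_zero.mp h3) hμν
  · exact h3

end general

end JointEigenbasis

namespace ShimuraData

open MeasureTheory JointEigenbasis

variable {K : Type*} [Field K] [NumberField K] [NumberField.IsCMField K] {τ₁ : K →+* ℂ}
  {H : Matrix (Fin 3) (Fin 3) K} {Q : Matrix (Fin 3) (Fin 3) ℂ} (hQ : IsFrame K τ₁ H Q)
  (S : Subgroup (GL (Fin 3) K)) (hS : (S : Set (GL (Fin 3) K)) ⊆ unitaryGroup K H)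
  [CompactSpace (ballQuotient hQ S hS)] {D : Set ball₂}

/-- **Petersson orthogonality of `T_δ`-eigenvectors with distinct eigenvalues**, when
`T_δ = T_{δ⁻¹}` on the Petersson space. -/
theorem heckeFamilyOf_inner_eq_zero_of_eigenvalue_ne (k : ℕ)
    (hD : IsBallFundamentalDomain hQ S hS D) (hDm : MeasurableSet D)
    (inst : ∀ δ : unitaryGroup K H,
      Fintype (S ⧸ (heckeSubgroup S (δ : GL (Fin 3) K)).subgroupOf S))
    {δ : unitaryGroup K H}
    (hself : heckeFamilyOf hQ S hS k hD hDm inst δ = heckeFamilyOf hQ S hS k hD hDm inst δ⁻¹)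
    {v w : PeterssonSpace hQ S hS k hD} (hv0 : v ≠ 0) {μ ν : ℂ}
    (hv : heckeFamilyOf hQ S hS k hD hDm inst δ v = μ • v)
    (hw : heckeFamilyOf hQ S hS k hD hDm inst δ w = ν • w) (hμν : μ ≠ ν) : inner ℂ v w = 0 := by
  have hadj : IsFormalAdjointPair (heckeFamilyOf hQ S hS k hD hDm inst δ)
      (heckeFamilyOf hQ S hS k hD hDm inst δ) := by
    have := isFormalAdjointPair_heckeFamilyOf hQ S hS k hD hDm inst δ
    rw [← hself] at this
    exact this
  exact hadj.inner_eq_zero_of_eigenvalue_ne hv0 hv hw hμν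

/-- **The Hodge period pairing of two `T_δ`-eigenforms with distinct eigenvalues vanishes**
(weight `3`, `T_δ = T_{δ⁻¹}`). -/
theorem setIntegral_hodgeWedge_eq_zero_of_eigenvalue_ne
    (hD : IsBallFundamentalDomain hQ S hS D) (hDm : MeasurableSet D)
    (inst : ∀ δ : unitaryGroup K H,
      Fintype (S ⧸ (heckeSubgroup S (δ : GL (Fin 3) K)).subgroupOf S))
    {δ : unitaryGroup K H}
    (hself : heckeFamilyOf hQ S hS 3 hD hDm inst δ = heckeFamilyOf hQ S hS 3 hD hDm inst δ⁻¹)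
    {f g : PeterssonForms hQ S hS 3 hD}
    (hf0 : (SeparationQuotient.mk f : PeterssonSpace hQ S hS 3 hD) ≠ 0) {μ ν : ℂ}
    (hf : heckeFamilyOf hQ S hS 3 hD hDm inst δ (SeparationQuotient.mk f)
      = μ • (SeparationQuotient.mk f : PeterssonSpace hQ S hS 3 hD))
    (hg : heckeFamilyOf hQ S hS 3 hD hDm inst δ (SeparationQuotient.mk g)
      = ν • (SeparationQuotient.mk g : PeterssonSpace hQ S hS 3 hD)) (hμν : μ ≠ ν) :
    ∫ x in Subtype.val '' D, hodgeWedge (PeterssonForms.toForm hQ S hS 3 hD f)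
      (PeterssonForms.toForm hQ S hS 3 hD g) x = 0 := by
  rw [setIntegral_hodgeWedge_eq_inner_mk hQ S hS hD hDm f g]
  have h0 : inner ℂ (SeparationQuotient.mk f : PeterssonSpace hQ S hS 3 hD)
      (SeparationQuotient.mk g) = 0 :=
    heckeFamilyOf_inner_eq_zero_of_eigenvalue_ne hQ S hS 3 hD hDm inst hself hf0 hf hg hμν
  rw [← inner_conj_symm, h0, map_zero, mul_zero]

end ShimuraData

end Summit.Ventures.HodgeRepro2
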